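import Literature.Analysis.FluidPDE.ConeVanish
import Literature.Analysis.FluidPDE.ConeDecay
import Literature.Analysis.FluidPDE.ConeBackwardUniqueness
import HarnessLib

/-!
# Li–Šverák 2012, Theorem 1.1 — backward uniqueness in cones: the proof

Analysis/FluidPDE discharge file (theorems only) for the named fact
`Literature.Analysis.FluidPDE.coneBackwardUniquenessC12` (`ConeBackwardUniqueness.lean`):
backward uniqueness for the backward heat inequality `|∂ₜu + Δu| ≤ c₁(|u| + |∇u|)` in the cones
`Γ_κ(e) = {κ‖y‖ < ⟪y, e⟫} ⊆ ℝ³`, `0 ≤ κ < 1/√3` (opening angle `θ > 2 arccos(1/√3)`), in the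
class `C¹₂`. The proof follows §2 of the paper on top of the preceding support files:

* `exists_cone_params` — the choice of `α = 2β ∈ ]1, 2[` in Prop. 2.3 ("there exists some
  `α = α(ε) ∈ (1, 2)`"): for `ε² < 1/3` the conditions of `carleman_inequality_cone` hold for
  `β < 1` close to `1`, by continuity from `β = 1` where `m(2, ε) = (1-ε²)(1-3ε²) > 0`;
* `cone_uc_step_c12` — the unique-continuation step of Lemma 2.4 ("Using the property of unique
  continuation across the spatial boundaries … we show that `v(y, s) = 0` if `y ∈ O_θ` and
  `0 < s < 1`"): the zero set propagates from the far part of the narrower cone `Γ_ε` to the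
  whole cone `Γ_κ` (a connectedness argument with Theorem 4.1 of [ESS] as the hypothesis `hUC`);
* `cone_rescale_hypotheses_c12`, `cone_strip_vanish_c12` — Lemma 2.4 (`u ≡ 0` on
  `O_θ × (0, γ₁)`): the decay (Lemma 2.2, `decay_gradient_cone_c12`), the rescaling
  `v(y,s) = u(λy, λ²s - γ₁)` (2.10), the Carleman step (`cone_vanish_of_carleman_c12`) and the
  unique-continuation step;
* `cone_backwardUniqueness_c12` — Theorem 1.1 in the class `C¹₂` by iteration of Lemma 2.4
  (as in the tree's `backwardUniqueness_uncurried_c12`), for any finite-dimensional `E`;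
* `coneBackwardUniquenessC12_holds` — the discharge on `ℝ³`, with ESS Thm. 4.1
  (`Carleman.uniqueContinuation_uncurried_c12 3 3`) as the unique-continuation input and the
  half-space case `κ = 0` from `ConeBU.halfspace`.

## References

* [LiSverak2012] Lu Li, V. Šverák, *Backward uniqueness for the heat equation in cones*,
  Comm. PDE 37 (2012), 1414–1429, arXiv:1011.2796 — Thm. 1.1, §2.
* [EscauriazaSereginSverak2003] L. Escauriaza, G. Seregin, V. Šverák, *`L_{3,∞}`-solutions of
  Navier–Stokes equations and backward uniqueness*, Russ. Math. Surv. 58 (2003) — Thm. 4.1, 5.1.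
-/

noncomputable section

open MeasureTheory Set Function Filter Metric
open _root_.Topology
open scoped InnerProductSpace RealInnerProductSpace ENNReal

namespace Literature.Analysis.FluidPDE

namespace Carleman

section ConeParams

/-- **The choice of `α = 2β ∈ ]1, 2[` in Prop. 2.3** ("For any `ε ∈ (0, 1/√3)` … there exists
some `α = α(ε) ∈ (1, 2)` such that the following inequality holds"): for `0 < ε`, `ε² < 1/3`
there is `β ∈ ]1/2, 1[` such that, with `η = ε^{2β}`, `2β - 1 - 2η ≥ 0`,
`m = (2β-1-2η)(1-η)² - 2ηε²(1-ε²) ≥ 0` and `c₂ = 8β²(1-η)² - 8βη(1-η) - 4β²η² > 0` (the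
hypotheses of `carleman_inequality_cone`); at `β = 1` these are `1 - 2ε² > 0`,
`(1-ε²)(1-3ε²) > 0`, `4(2 - 6ε² + 3ε⁴) > 0`, and they persist for `β < 1` close to `1` by
continuity. [cite: LiSverak2012, Prop. 2.3 and §4, (4.15)] -/
theorem exists_cone_params {ε : ℝ} (hε0 : 0 < ε) (hε : ε ^ 2 < 1 / 3) :
    ∃ β : ℝ, 1 / 2 < β ∧ β < 1 ∧ 0 ≤ 2 * β - 1 - 2 * ε ^ (2 * β) ∧
      0 ≤ (2 * β - 1 - 2 * ε ^ (2 * β)) * (1 - ε ^ (2 * β)) ^ 2 -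
        2 * ε ^ (2 * β) * ε ^ 2 * (1 - ε ^ 2) ∧
      0 < 8 * β ^ 2 * (1 - ε ^ (2 * β)) ^ 2 - 8 * β * ε ^ (2 * β) * (1 - ε ^ (2 * β)) -
        4 * β ^ 2 * (ε ^ (2 * β)) ^ 2 := by
  -- the three quantities as continuous functions of `β`
  have hpow : Continuous fun β : ℝ => ε ^ (2 * β) :=
    (Real.continuous_const_rpow hε0.ne').comp (continuous_const.mul continuous_id)
  set f₁ : ℝ → ℝ := fun β => 2 * β - 1 - 2 * ε ^ (2 * β) with hf₁
  set f₂ : ℝ → ℝ := fun β => (2 * β - 1 - 2 * ε ^ (2 * β)) * (1 - ε ^ (2 * β)) ^ 2 -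
    2 * ε ^ (2 * β) * ε ^ 2 * (1 - ε ^ 2) with hf₂
  set f₃ : ℝ → ℝ := fun β => 8 * β ^ 2 * (1 - ε ^ (2 * β)) ^ 2 -
    8 * β * ε ^ (2 * β) * (1 - ε ^ (2 * β)) - 4 * β ^ 2 * (ε ^ (2 * β)) ^ 2 with hf₃
  have hc₁ : Continuous f₁ := ((continuous_const.mul continuous_id).sub continuous_const).sub
    (continuous_const.mul hpow)
  have hc₂ : Continuous f₂ :=
    ((((continuous_const.mul continuous_id).sub continuous_const).sub
      (continuous_const.mul hpow)).mul ((continuous_const.sub hpow).pow 2)).sub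
      (((continuous_const.mul hpow).mul continuous_const).mul continuous_const)
  have hc₃ : Continuous f₃ :=
    ((((continuous_const.mul (continuous_id.pow 2)).mul ((continuous_const.sub hpow).pow 2)).sub
      (((continuous_const.mul continuous_id).mul hpow).mul (continuous_const.sub hpow))).sub
      ((continuous_const.mul (continuous_id.pow 2)).mul (hpow.pow 2)))
  -- the values at `β = 1`
  have he1 : ε ^ (2 * (1 : ℝ)) = ε ^ 2 := by rw [mul_one, Real.rpow_two]
  set x : ℝ := ε ^ 2 with hx
  have hx0 : 0 < x := by positivity
  have h1 : 0 < f₁ 1 := by simp only [hf₁, he1]; linarith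
  have h2 : 0 < f₂ 1 := by
    simp only [hf₂, he1]
    have : (2 * 1 - 1 - 2 * x) * (1 - x) ^ 2 - 2 * x * x * (1 - x) = (1 - x) * (1 - 3 * x) := by ring
    rw [this]
    exact mul_pos (by linarith) (by linarith)
  have h3 : 0 < f₃ 1 := by
    simp only [hf₃, he1]
    nlinarith
  -- continuity at `1`
  have e1 : ∀ᶠ β in 𝓝 (1 : ℝ), 0 < f₁ β := hc₁.continuousAt.eventually (lt_mem_nhds h1)
  have e2 : ∀ᶠ β in 𝓝 (1 : ℝ), 0 < f₂ β := hc₂.continuousAt.eventually (lt_mem_nhds h2)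
  have e3 : ∀ᶠ β in 𝓝 (1 : ℝ), 0 < f₃ β := hc₃.continuousAt.eventually (lt_mem_nhds h3)
  have e4 : ∀ᶠ β in 𝓝[<] (1 : ℝ), β ∈ Ioo (1 / 2 : ℝ) 1 := Ioo_mem_nhdsLT (by norm_num)
  have eall := ((e1.and (e2.and e3)).filter_mono nhdsWithin_le_nhds).and e4
  obtain ⟨β, ⟨hβ1, hβ2, hβ3⟩, hβI⟩ := eall.exists
  exact ⟨β, hβI.1, hβI.2, hβ1.le, hβ2.le, hβ3⟩

end ConeParams

section ConeGeometry

variable {E : Type*} [NormedAddCommGroup E] [InnerProductSpace ℝ E]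

/-- **The cone is convex** (`κ ≥ 0`). [folklore] -/
theorem convex_coneSet {κ : ℝ} (hκ : 0 ≤ κ) (e : E) : Convex ℝ {x : E | κ * ‖x‖ < ⟪x, e⟫} := by
  rw [convex_iff_forall_pos]
  intro x hx y hy a b ha hb hab
  simp only [mem_setOf_eq] at hx hy ⊢
  rw [inner_add_left, real_inner_smul_left, real_inner_smul_left]
  have h1 : ‖a • x + b • y‖ ≤ a * ‖x‖ + b * ‖y‖ := by
    refine (norm_add_le _ _).trans ?_
    rw [norm_smul, norm_smul, Real.norm_eq_abs, Real.norm_eq_abs, abs_of_pos ha, abs_of_pos hb]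
  have h2 : κ * ‖a • x + b • y‖ ≤ κ * (a * ‖x‖ + b * ‖y‖) := mul_le_mul_of_nonneg_left h1 hκ
  have h3 : a * (κ * ‖x‖) < a * ⟪x, e⟫ := mul_lt_mul_of_pos_left hx ha
  have h4 : b * (κ * ‖y‖) < b * ⟪y, e⟫ := mul_lt_mul_of_pos_left hy hb
  nlinarith

/-- **The cone is scale invariant**: `l • y ∈ Γ_κ(e)` iff `y ∈ Γ_κ(e)` for `l > 0`. [folklore] -/
theorem smul_mem_coneSet_iff {κ l : ℝ} (hl : 0 < l) (e y : E) :
    κ * ‖l • y‖ < ⟪l • y, e⟫ ↔ κ * ‖y‖ < ⟪y, e⟫ := by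
  rw [norm_smul, Real.norm_eq_abs, abs_of_pos hl, real_inner_smul_left,
    show κ * (l * ‖y‖) = l * (κ * ‖y‖) by ring]
  exact ⟨fun h => lt_of_mul_lt_mul_left h hl.le, fun h => mul_lt_mul_of_pos_left h hl⟩

/-- The axis point `ρ e` lies in every cone `Γ_κ(e)` with `κ < 1` (`ρ > 0`, `‖e‖ = 1`), and
`φ₀(ρe) = (1 - η)ρ^{2β}`. [folklore] -/
theorem axis_mem_coneSet {e : E} (he : ‖e‖ = 1) {κ ρ : ℝ} (hκ : κ < 1) (hρ : 0 < ρ) :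
    κ * ‖ρ • e‖ < ⟪ρ • e, e⟫ ∧ ⟪ρ • e, e⟫ = ρ ∧ ‖ρ • e‖ = ρ := by
  have h1 : ‖ρ • e‖ = ρ := by rw [norm_smul, Real.norm_eq_abs, abs_of_pos hρ, he, mul_one]
  have h2 : ⟪ρ • e, e⟫ = ρ := by
    rw [real_inner_smul_left, real_inner_self_eq_norm_sq, he]; ring
  refine ⟨?_, h2, h1⟩
  rw [h1, h2]
  nlinarith

/-- `φ₀(ρe) = (1 - η)ρ^{2β}` on the axis (`ρ > 0`, `‖e‖ = 1`). [folklore] -/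
theorem conePhi0_axis {e : E} (he : ‖e‖ = 1) (β η : ℝ) {ρ : ℝ} (hρ : 0 < ρ) :
    conePhi0 β η e (ρ • e) = (1 - η) * ρ ^ (2 * β) := by
  obtain ⟨-, h2, h1⟩ := axis_mem_coneSet he (zero_lt_one) hρ
  rw [conePhi0, h2, h1, ← Real.rpow_natCast ρ 2, ← Real.rpow_mul hρ.le]
  push_cast
  ring

end ConeGeometry

/-! ### The unique continuation step -/

section ConeUC

variable {E : Type*} [NormedAddCommGroup E] [InnerProductSpace ℝ E] [FiniteDimensional ℝ E]
  [MeasurableSpace E] [BorelSpace E]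
variable {F : Type*} [NormedAddCommGroup F] [InnerProductSpace ℝ F] [CompleteSpace F]

omit [MeasurableSpace E] [BorelSpace E] [CompleteSpace F] in
/-- **Propagation of the zero set across balls** (the way Theorem 4.1 of [ESS] is used in the
proof of Lemma 2.4): if `v` (backward heat inequality on `]1/2, 3/2[ × Γ`, `Γ` open) vanishes on
`[s₀, s₁[ × B(y, r)` (`1/2 < s₀ < s₁ < 3/2`, `r > 0`) and `B̄(y, R) ⊆ Γ`, then `v` vanishes on
`[s₀, s₁[ × B(y, R)`: apply unique continuation across spatial boundaries (`hUC`) to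
`V(τ, ξ) = v(s + τ, y + ξ)` on `]0, s₁ - s[ × B(0, R)`. [cite: LiSverak2012, proof of Lemma 2.4] -/
theorem cone_zero_propagation_c12
    (hUC : ∀ (c R T : ℝ), 0 ≤ c → 0 < R → 0 < T → ∀ U : ℝ × E → F,
      ContDiffOn ℝ 1 U (Ioo (0 : ℝ) T ×ˢ ball (0 : E) R) →
      (∀ e' : E, ContDiffOn ℝ 1 (dx e' U) (Ioo (0 : ℝ) T ×ˢ ball (0 : E) R)) →
      ContinuousOn U (Ico (0 : ℝ) T ×ˢ ball (0 : E) R) →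
      (∀ z ∈ Ioo (0 : ℝ) T ×ˢ ball (0 : E) R,
        ‖dt U z + lap U z‖ ≤ c * (‖U z‖ + Real.sqrt (gradSq U z))) →
      (∀ k : ℕ, ∃ C : ℝ, ∀ z ∈ Ioo (0 : ℝ) T ×ˢ ball (0 : E) R,
        ‖U z‖ ≤ C * (‖z.2‖ + Real.sqrt z.1) ^ k) →
      ∀ x ∈ ball (0 : E) R, U (0, x) = 0)
    {v : ℝ × E → F} {Γ : Set E} {c s₀ s₁ r R : ℝ} {y : E} (hΓ : IsOpen Γ) (hc : 0 ≤ c)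
    (hs₀ : 1 / 2 < s₀) (hs₁ : s₁ < 3 / 2) (hr : 0 < r) (hR : 0 < R)
    (hyR : closedBall y R ⊆ Γ)
    (hv : ContDiffOn ℝ 1 v (Ioo (1 / 2 : ℝ) (3 / 2) ×ˢ Γ))
    (hvx : ∀ e' : E, ContDiffOn ℝ 1 (dx e' v) (Ioo (1 / 2 : ℝ) (3 / 2) ×ˢ Γ))
    (hBH : ∀ z ∈ Ioo (1 / 2 : ℝ) (3 / 2) ×ˢ Γ,
      ‖dt v z + lap v z‖ ≤ c * (‖v z‖ + Real.sqrt (gradSq v z)))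
    (hzero : ∀ s ∈ Ico s₀ s₁, ∀ y' ∈ ball y r, v (s, y') = 0) :
    ∀ s ∈ Ico s₀ s₁, ∀ x ∈ ball y R, v (s, x) = 0 := by
  intro s hs x hx
  obtain ⟨hss₀, hss₁⟩ := hs
  set O : Set (ℝ × E) := Ioo (1 / 2 : ℝ) (3 / 2) ×ˢ Γ with hO
  have hOo : IsOpen O := isOpen_Ioo.prod hΓ
  set T : ℝ := s₁ - s with hT
  have hT0 : 0 < T := by rw [hT]; linarith
  have hballΓ : ball y R ⊆ Γ := ball_subset_closedBall.trans hyR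
  -- the translated function
  set V : ℝ × E → F := fun z => v (stAffine ((1 : ℝ) ^ 2) 1 s y z) with hV
  have hΦ : ∀ z : ℝ × E, stAffine ((1 : ℝ) ^ 2) 1 s y z = (s + z.1, y + z.2) := by
    intro z; simp [stAffine]
  have hmapO : Ioo (0 : ℝ) T ×ˢ ball (0 : E) R ⊆ stAffine ((1 : ℝ) ^ 2) 1 s y ⁻¹' O := by
    intro z hz
    rw [mem_preimage, hΦ]
    refine ⟨⟨by linarith [hz.1.1], by rw [hT] at hz; linarith [hz.1.2]⟩, hballΓ ?_⟩
    have := hz.2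
    rw [mem_ball, dist_zero_right] at this
    rwa [mem_ball, dist_eq_norm, add_sub_cancel_left]
  have hmapO' : Ico (0 : ℝ) T ×ˢ ball (0 : E) R ⊆ stAffine ((1 : ℝ) ^ 2) 1 s y ⁻¹' O := by
    intro z hz
    rw [mem_preimage, hΦ]
    refine ⟨⟨by linarith [hz.1.1], by rw [hT] at hz; linarith [hz.1.2]⟩, hballΓ ?_⟩
    have := hz.2
    rw [mem_ball, dist_zero_right] at this
    rwa [mem_ball, dist_eq_norm, add_sub_cancel_left]
  have hV2 : ContDiffOn ℝ 1 V (Ioo (0 : ℝ) T ×ˢ ball (0 : E) R) :=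
    (contDiffOn_comp_stAffine hv ((1 : ℝ) ^ 2) 1 s y).mono hmapO
  have hV2x : ∀ e' : E, ContDiffOn ℝ 1 (dx e' V) (Ioo (0 : ℝ) T ×ˢ ball (0 : E) R) := fun e' =>
    (contDiffOn_one_dx_comp_stAffine_c12 (by norm_num) one_ne_zero hvx s y e').mono hmapO
  have hVc : ContinuousOn V (Ico (0 : ℝ) T ×ˢ ball (0 : E) R) :=
    (continuousOn_comp_stAffine hv.continuousOn ((1 : ℝ) ^ 2) 1 s y).mono hmapO'
  have hVBH : ∀ z ∈ Ioo (0 : ℝ) T ×ˢ ball (0 : E) R,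
      ‖dt V z + lap V z‖ ≤ c * (‖V z‖ + Real.sqrt (gradSq V z)) := by
    intro z hz
    have h := backwardHeat_comp_stAffine (t₀ := s) (x₀ := y) hc zero_lt_one le_rfl hBH z (hmapO hz)
    rw [mul_one] at h
    exact h
  -- boundedness on the cylinder
  set K : Set (ℝ × E) := Icc s s₁ ×ˢ closedBall y R with hK
  have hKc : IsCompact K := isCompact_Icc.prod (isCompact_closedBall _ _)
  have hKsub : K ⊆ O := by
    intro w hw
    exact ⟨⟨by linarith [hw.1.1], by linarith [hw.1.2]⟩, hyR hw.2⟩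
  obtain ⟨M, hM⟩ := hKc.exists_bound_of_continuousOn (hv.continuousOn.mono hKsub)
  have hM0 : 0 ≤ M :=
    le_trans (norm_nonneg _) (hM (s, y) ⟨⟨le_rfl, by linarith⟩, mem_closedBall_self hR.le⟩)
  have hVK : ∀ z ∈ Ioo (0 : ℝ) T ×ˢ ball (0 : E) R, ‖V z‖ ≤ M := by
    intro z hz
    apply hM
    rw [hΦ]
    refine ⟨⟨by linarith [hz.1.1], by rw [hT] at hz; linarith [hz.1.2]⟩, ?_⟩
    rw [mem_closedBall, dist_eq_norm, add_sub_cancel_left]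
    have := hz.2; rw [mem_ball, dist_zero_right] at this; exact this.le
  -- vanishing to infinite order at `(0, 0)`
  have hVvan : ∀ k : ℕ, ∃ C : ℝ, ∀ z ∈ Ioo (0 : ℝ) T ×ˢ ball (0 : E) R,
      ‖V z‖ ≤ C * (‖z.2‖ + Real.sqrt z.1) ^ k := by
    intro k
    refine ⟨M * r⁻¹ ^ k, fun z hz => ?_⟩
    by_cases hsmall : ‖z.2‖ < r
    · have h0 : V z = 0 := by
        show v (stAffine ((1 : ℝ) ^ 2) 1 s y z) = 0
        rw [hΦ]
        refine hzero _ ⟨by linarith [hz.1.1], by rw [hT] at hz; linarith [hz.1.2]⟩ _ ?_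
        rwa [mem_ball, dist_eq_norm, add_sub_cancel_left]
      rw [h0, norm_zero]
      positivity
    · push Not at hsmall
      have h1 : r ≤ ‖z.2‖ + Real.sqrt z.1 := by linarith [Real.sqrt_nonneg z.1]
      have h2 : (1 : ℝ) ≤ (r⁻¹ * (‖z.2‖ + Real.sqrt z.1)) ^ k := by
        refine one_le_pow₀ ?_
        rw [le_inv_mul_iff₀ hr, mul_one]; exact h1
      calc ‖V z‖ ≤ M := hVK z hz
        _ = M * 1 := (mul_one _).symm
        _ ≤ M * (r⁻¹ * (‖z.2‖ + Real.sqrt z.1)) ^ k := mul_le_mul_of_nonneg_left h2 hM0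
        _ = M * r⁻¹ ^ k * (‖z.2‖ + Real.sqrt z.1) ^ k := by rw [mul_pow]; ring
  -- unique continuation
  have huc := hUC c R T hc hR hT0 V hV2 hV2x hVc hVBH hVvan
  have hξ : x - y ∈ ball (0 : E) R := by
    rwa [mem_ball, dist_zero_right, ← dist_eq_norm]
  have h := huc _ hξ
  have e1 : V (0, x - y) = v (s, x) := by
    show v (stAffine ((1 : ℝ) ^ 2) 1 s y (0, x - y)) = v (s, x)
    rw [hΦ]
    congr 1
    simp
  rw [e1] at h
  exact h

omit [MeasurableSpace E] [BorelSpace E] [CompleteSpace F] in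
/-- **The unique-continuation step of Lemma 2.4 in the cone** ("Using the property of unique
continuation across the spatial boundaries (see Theorem 4.1 in [ESS]), we show that
`v(y, s) = 0` if `y ∈ O_θ` and `0 < s < 1`"). If `v` solves the backward heat inequality on
`]1/2, 3/2[ × Γ_κ(e)` (`0 ≤ κ ≤ ε < 1`, `κ < 1`) and vanishes at every `(s, y)` with
`1/2 < s < 1`, `ε‖y‖ < ⟪y,e⟫`, `⟪y,e⟫ > 1` and `k₁(s)φ₀(y) > B` (`φ₀` with `η < 1`,
`β ≥ 1/2`), then `v ≡ 0` on `]1/2, 1[ × Γ_κ(e)`. Proof: for `1/2 < s₀ < s₁ < 1` the set of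
`y ∈ Γ_κ` near which `v = 0` on `[s₀, s₁[` is open, relatively closed
(`cone_zero_propagation_c12`), and contains the axis points `ρe`, `ρ` large (tube lemma); the
cone is convex, hence connected. [cite: LiSverak2012, proof of Lemma 2.4] -/
theorem cone_uc_step_c12
    (hUC : ∀ (c R T : ℝ), 0 ≤ c → 0 < R → 0 < T → ∀ U : ℝ × E → F,
      ContDiffOn ℝ 1 U (Ioo (0 : ℝ) T ×ˢ ball (0 : E) R) →
      (∀ e' : E, ContDiffOn ℝ 1 (dx e' U) (Ioo (0 : ℝ) T ×ˢ ball (0 : E) R)) →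
      ContinuousOn U (Ico (0 : ℝ) T ×ˢ ball (0 : E) R) →
      (∀ z ∈ Ioo (0 : ℝ) T ×ˢ ball (0 : E) R,
        ‖dt U z + lap U z‖ ≤ c * (‖U z‖ + Real.sqrt (gradSq U z))) →
      (∀ k : ℕ, ∃ C : ℝ, ∀ z ∈ Ioo (0 : ℝ) T ×ˢ ball (0 : E) R,
        ‖U z‖ ≤ C * (‖z.2‖ + Real.sqrt z.1) ^ k) →
      ∀ x ∈ ball (0 : E) R, U (0, x) = 0)
    {v : ℝ × E → F} {e : E} {κ ε β η B c : ℝ} (he : ‖e‖ = 1) (hc : 0 ≤ c) (hκ0 : 0 ≤ κ)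
    (hκ1 : κ < 1) (hκε : κ ≤ ε) (hε1 : ε < 1) (hβ : 1 / 2 ≤ β) (hη1 : η < 1)
    (hv : ContDiffOn ℝ 1 v (Ioo (1 / 2 : ℝ) (3 / 2) ×ˢ {y : E | κ * ‖y‖ < ⟪y, e⟫}))
    (hvx : ∀ e' : E, ContDiffOn ℝ 1 (dx e' v) (Ioo (1 / 2 : ℝ) (3 / 2) ×ˢ {y : E | κ * ‖y‖ < ⟪y, e⟫}))
    (hBH : ∀ z ∈ Ioo (1 / 2 : ℝ) (3 / 2) ×ˢ {y : E | κ * ‖y‖ < ⟪y, e⟫},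
      ‖dt v z + lap v z‖ ≤ c * (‖v z‖ + Real.sqrt (gradSq v z)))
    (hvan : ∀ z ∈ Ioo (1 / 2 : ℝ) (3 / 2) ×ˢ {y : E | κ * ‖y‖ < ⟪y, e⟫}, z.1 < 1 →
      ε * ‖z.2‖ < ⟪z.2, e⟫ → 1 < ⟪z.2, e⟫ → B < kA 1 z.1 * conePhi0 β η e z.2 → v z = 0) :
    ∀ s ∈ Ioo (1 / 2 : ℝ) 1, ∀ y : E, κ * ‖y‖ < ⟪y, e⟫ → v (s, y) = 0 := by
  intro s₀ hs₀ y₀ hy₀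
  obtain ⟨hs₀1, hs₀2⟩ := hs₀
  set Γ : Set E := {y : E | κ * ‖y‖ < ⟪y, e⟫} with hΓ
  have hΓo : IsOpen Γ := isOpen_coneSet κ e
  set O : Set (ℝ × E) := Ioo (1 / 2 : ℝ) (3 / 2) ×ˢ Γ with hO
  set s₁ : ℝ := (s₀ + 1) / 2 with hs₁
  have hs₁0 : s₀ < s₁ := by rw [hs₁]; linarith
  have hs₁1 : s₁ < 1 := by rw [hs₁]; linarith
  -- ### the zero set `Z`
  set Z : Set E := {y : E | ∃ r : ℝ, 0 < r ∧ ball y r ⊆ Γ ∧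
    ∀ s ∈ Ico s₀ s₁, ∀ y' ∈ ball y r, v (s, y') = 0} with hZ
  have hZΓ : Z ⊆ Γ := fun y ⟨r, hr, hb, _⟩ => hb (mem_ball_self hr)
  -- `Z` is open
  have hZo : IsOpen Z := by
    rw [Metric.isOpen_iff]
    rintro y ⟨r, hr, hb, hz⟩
    refine ⟨r / 2, by positivity, fun y' hy' => ⟨r / 2, by positivity, ?_, ?_⟩⟩
    · exact (ball_subset_ball' (by rw [mem_ball] at hy'; linarith [hy'.le])).trans hb
    · intro s hs y'' hy''
      exact hz s hs y'' (ball_subset_ball' (by rw [mem_ball] at hy'; linarith [hy'.le]) hy'')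
  -- propagation: `y ∈ Z`, `B̄(y, R) ⊆ Γ` ⟹ zero on `[s₀, s₁[ × B(y, R)`
  have hprop : ∀ y ∈ Z, ∀ R : ℝ, 0 < R → closedBall y R ⊆ Γ →
      ∀ s ∈ Ico s₀ s₁, ∀ x ∈ ball y R, v (s, x) = 0 := by
    rintro y ⟨r, hr, -, hz⟩ R hR hyR
    exact cone_zero_propagation_c12 hUC hΓo hc hs₀1 (by linarith) hr hR hyR hv hvx hBH hz
  -- `Z` is relatively closed in `Γ`
  have hZc : ∀ y ∈ Γ, y ∈ closure Z → y ∈ Z := by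
    intro y hy hyc
    obtain ⟨R₀, hR₀, hbR₀⟩ := Metric.isOpen_iff.1 hΓo y hy
    set R : ℝ := R₀ / 4 with hR
    have hR0 : 0 < R := by positivity
    have h3R : closedBall y (3 * R) ⊆ Γ := (closedBall_subset_ball (by rw [hR]; linarith)).trans hbR₀
    obtain ⟨ξ, hξZ, hξy⟩ := Metric.mem_closure_iff.1 hyc R hR0
    have hξR : closedBall ξ (2 * R) ⊆ Γ := by
      refine Subset.trans ?_ h3R
      intro w hw
      rw [mem_closedBall] at hw ⊢
      linarith [dist_triangle w ξ y, dist_comm ξ y]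
    have hzero := hprop ξ hξZ (2 * R) (by positivity) hξR
    refine ⟨R, hR0, (ball_subset_closedBall.trans ((closedBall_subset_closedBall (by linarith)).trans
      h3R)), fun s hs y' hy' => hzero s hs y' ?_⟩
    rw [mem_ball] at hy' ⊢
    linarith [dist_triangle y' y ξ, dist_comm ξ y]
  -- ### the seed on the axis
  have hZne : (Γ ∩ Z).Nonempty := by
    -- the threshold for `ρ`
    have hk₁ : 0 < kA 1 s₁ := by
      rw [kA_one_eq (by linarith)]; exact div_pos (by linarith) (by linarith)
    have hη1' : 0 < 1 - η := by linarith
    set ρ : ℝ := max 2 (B / (kA 1 s₁ * (1 - η)) + 1) with hρ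
    have hρ2 : 2 ≤ ρ := le_max_left _ _
    have hρ0 : 0 < ρ := by linarith
    have hρB : B / (kA 1 s₁ * (1 - η)) < ρ := lt_of_lt_of_le (by linarith) (le_max_right _ _)
    obtain ⟨hρΓ, hρe, hρn⟩ := axis_mem_coneSet he hκ1 hρ0
    have hρΓ' : ρ • e ∈ Γ := hρΓ
    -- the open set on which `v` vanishes
    set P : Set (ℝ × E) := {z : ℝ × E | 1 / 2 < z.1 ∧ z.1 < 1 ∧ ε * ‖z.2‖ < ⟪z.2, e⟫ ∧
      1 < ⟪z.2, e⟫ ∧ B < kA 1 z.1 * conePhi0 β η e z.2} with hP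
    have hβ0 : 0 < β := by linarith
    have hLc : ContinuousOn (fun z : ℝ × E => kA 1 z.1 * conePhi0 β η e z.2) {z : ℝ × E | 0 < z.1} :=
      ((contDiffOn_kA 1).continuousOn.comp continuous_fst.continuousOn fun z hz => hz).mul
        ((continuous_conePhi0 hβ0 η e).comp continuous_snd).continuousOn
    have hPo : IsOpen P := by
      have h1 : IsOpen ({z : ℝ × E | 0 < z.1} ∩
          (fun z : ℝ × E => kA 1 z.1 * conePhi0 β η e z.2) ⁻¹' Ioi B) :=
        hLc.isOpen_inter_preimage (isOpen_lt continuous_const continuous_fst) isOpen_Ioi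
      have hce : Continuous fun z : ℝ × E => ⟪z.2, e⟫ := continuous_snd.inner continuous_const
      have h2 : P = ({z : ℝ × E | 1 / 2 < z.1} ∩ {z : ℝ × E | z.1 < 1} ∩
          {z : ℝ × E | ε * ‖z.2‖ < ⟪z.2, e⟫} ∩ {z : ℝ × E | 1 < ⟪z.2, e⟫}) ∩
          ({z : ℝ × E | 0 < z.1} ∩ (fun z : ℝ × E => kA 1 z.1 * conePhi0 β η e z.2) ⁻¹' Ioi B) := by
        ext z
        simp only [hP, mem_setOf_eq, mem_inter_iff, mem_preimage, mem_Ioi]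
        constructor
        · rintro ⟨h1, h2, h3, h4, h5⟩; exact ⟨⟨⟨⟨h1, h2⟩, h3⟩, h4⟩, by linarith, h5⟩
        · rintro ⟨⟨⟨⟨h1, h2⟩, h3⟩, h4⟩, -, h5⟩; exact ⟨h1, h2, h3, h4, h5⟩
      rw [h2]
      refine IsOpen.inter (((IsOpen.inter ?_ ?_).inter ?_).inter ?_) h1
      · exact isOpen_lt continuous_const continuous_fst
      · exact isOpen_lt continuous_fst continuous_const
      · exact isOpen_lt (continuous_const.mul continuous_snd.norm) hce
      · exact isOpen_lt continuous_const hce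
    have hPzero : ∀ z ∈ P, v z = 0 := by
      intro z hz
      obtain ⟨h1, h2, h3, h4, h5⟩ := hz
      have hzΓ : z.2 ∈ Γ := by
        show κ * ‖z.2‖ < ⟪z.2, e⟫
        nlinarith [norm_nonneg z.2]
      exact hvan z ⟨⟨h1, by linarith⟩, hzΓ⟩ h2 h3 h4 h5
    -- the segment `[s₀, s₁] × {ρe}` lies in `P`
    have hseg : Icc s₀ s₁ ×ˢ ({ρ • e} : Set E) ⊆ P := by
      rintro ⟨s, y⟩ ⟨hs, hy⟩
      rw [mem_singleton_iff] at hy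
      subst hy
      refine ⟨by linarith [hs.1], by linarith [hs.2], ?_, by rw [hρe]; linarith, ?_⟩
      · rw [hρn, hρe]; nlinarith
      · show B < kA 1 s * conePhi0 β η e (ρ • e)
        rw [conePhi0_axis he β η hρ0]
        -- `k₁(s) ≥ k₁(s₁)` for `s ≤ s₁`, `ρ^{2β} ≥ ρ`
        have hs0 : 0 < s := by linarith [hs.1]
        have hk : kA 1 s₁ ≤ kA 1 s := by
          rw [kA_one_eq hs0, kA_one_eq (by linarith), div_le_div_iff₀ (by linarith) hs0]
          nlinarith [hs.2]
        have hρpow : ρ ≤ ρ ^ (2 * β) := by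
          conv_lhs => rw [← Real.rpow_one ρ]
          exact Real.rpow_le_rpow_of_exponent_le (by linarith) (by linarith)
        have h1 : B < kA 1 s₁ * (1 - η) * ρ := by
          rw [div_lt_iff₀ (mul_pos hk₁ hη1')] at hρB; linarith
        have h2 : kA 1 s₁ * (1 - η) * ρ ≤ kA 1 s * ((1 - η) * ρ ^ (2 * β)) := by
          have := mul_le_mul hk (mul_le_mul_of_nonneg_left hρpow hη1'.le) (by positivity)
            (kA_one_nonneg hs0 (by linarith [hs.2]))
          linarith [this]
        linarith
    obtain ⟨U, V, hUo, hVo, hsU, hρV, hUV⟩ :=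
      generalized_tube_lemma isCompact_Icc isCompact_singleton hPo hseg
    have hρV' : ρ • e ∈ V := hρV (mem_singleton _)
    obtain ⟨r₁, hr₁, hbr₁⟩ := Metric.isOpen_iff.1 hVo (ρ • e) hρV'
    obtain ⟨r₂, hr₂, hbr₂⟩ := Metric.isOpen_iff.1 hΓo (ρ • e) hρΓ'
    refine ⟨ρ • e, hρΓ', min r₁ r₂, lt_min hr₁ hr₂, (ball_subset_ball (min_le_right _ _)).trans hbr₂,
      fun s hs y' hy' => hPzero (s, y') (hUV ⟨hsU ⟨hs.1, hs.2.le⟩, hbr₁ ?_⟩)⟩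
    exact ball_subset_ball (min_le_left _ _) hy'
  -- ### connectedness
  have hconn : IsPreconnected Γ := (convex_coneSet hκ0 e).isPreconnected
  have hcover : Γ ⊆ Z ∪ (closure Z)ᶜ := by
    intro y hy
    by_cases h : y ∈ closure Z
    · exact Or.inl (hZc y hy h)
    · exact Or.inr h
  have hdisj : Disjoint Z (closure Z)ᶜ :=
    disjoint_compl_right.mono_left subset_closure
  have hΓZ : Γ ⊆ Z := hconn.subset_left_of_subset_union hZo isClosed_closure.isOpen_compl hdisj hcover hZne
  obtain ⟨r, hr, -, hz⟩ := hΓZ hy₀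
  exact hz s₀ ⟨le_rfl, hs₁0⟩ y₀ (mem_ball_self hr)

end ConeUC

/-! ### Lemma 2.4: vanishing on a short time strip -/

section ConeStrip

variable {E : Type*} [NormedAddCommGroup E] [InnerProductSpace ℝ E] [FiniteDimensional ℝ E]
  [MeasurableSpace E] [BorelSpace E]
variable {F : Type*} [NormedAddCommGroup F] [InnerProductSpace ℝ F] [CompleteSpace F]

omit [CompleteSpace F] in
/-- **The rescalings (2.10) and of the iteration** in the cone (which is scale invariant): let
`0 < l ≤ 1`, `0 ≤ g`, `g + l² ≤ 1`, and let `u` be of class `C¹ ∩ {∂ₓu ∈ C¹}` on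
`Q = ]0,1[ × Γ_κ(e)` with `|∂ₜu + Δu| ≤ c₁(|u| + |∇u|)`, `|u| ≤ 1`, `∂ₜu` square integrable on
bounded measurable subsets, continuous on `[g, 1[ × Γ_κ(e)` and vanishing on `t = g`. Then
`w(s, y) = u(g + l²s, l y)` has the same properties on `Q` (with `g = 0`).
[cite: LiSverak2012, (2.10)–(2.12)] -/
theorem cone_rescale_hypotheses_c12 {u : ℝ × E → F} {e : E} {κ c₁ l g : ℝ}
    (hc₁ : 0 ≤ c₁) (hl0 : 0 < l) (hl1 : l ≤ 1) (hg0 : 0 ≤ g) (hgl : g + l ^ 2 ≤ 1)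
    (hu : ContDiffOn ℝ 1 u (Ioo (0 : ℝ) 1 ×ˢ {x : E | κ * ‖x‖ < ⟪x, e⟫}))
    (hux : ∀ e' : E, ContDiffOn ℝ 1 (dx e' u) (Ioo (0 : ℝ) 1 ×ˢ {x : E | κ * ‖x‖ < ⟪x, e⟫}))
    (hcont : ContinuousOn u (Ico g 1 ×ˢ {x : E | κ * ‖x‖ < ⟪x, e⟫}))
    (h0 : ∀ x : E, κ * ‖x‖ < ⟪x, e⟫ → u (g, x) = 0)
    (hBH : ∀ z ∈ Ioo (0 : ℝ) 1 ×ˢ {x : E | κ * ‖x‖ < ⟪x, e⟫},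
      ‖dt u z + lap u z‖ ≤ c₁ * (‖u z‖ + Real.sqrt (gradSq u z)))
    (hbound : ∀ z ∈ Ioo (0 : ℝ) 1 ×ˢ {x : E | κ * ‖x‖ < ⟪x, e⟫}, ‖u z‖ ≤ 1)
    (hH3 : ∀ K ⊆ Ioo (0 : ℝ) 1 ×ˢ {x : E | κ * ‖x‖ < ⟪x, e⟫}, Bornology.IsBounded K →
      MeasurableSet K → ∫⁻ z in K, ‖dt u z‖ₑ ^ 2 < ∞) :
    ContDiffOn ℝ 1 (fun z => u (stAffine (l ^ 2) l g 0 z)) (Ioo (0 : ℝ) 1 ×ˢ {x : E | κ * ‖x‖ < ⟪x, e⟫}) ∧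
    (∀ e' : E, ContDiffOn ℝ 1 (dx e' fun z => u (stAffine (l ^ 2) l g 0 z))
      (Ioo (0 : ℝ) 1 ×ˢ {x : E | κ * ‖x‖ < ⟪x, e⟫})) ∧
    ContinuousOn (fun z => u (stAffine (l ^ 2) l g 0 z)) (Ico (0 : ℝ) 1 ×ˢ {x : E | κ * ‖x‖ < ⟪x, e⟫}) ∧
    (∀ x : E, κ * ‖x‖ < ⟪x, e⟫ → u (stAffine (l ^ 2) l g 0 ((0 : ℝ), x)) = 0) ∧
    (∀ z ∈ Ioo (0 : ℝ) 1 ×ˢ {x : E | κ * ‖x‖ < ⟪x, e⟫},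
      ‖dt (fun z => u (stAffine (l ^ 2) l g 0 z)) z + lap (fun z => u (stAffine (l ^ 2) l g 0 z)) z‖ ≤
        c₁ * (‖u (stAffine (l ^ 2) l g 0 z)‖ +
          Real.sqrt (gradSq (fun z => u (stAffine (l ^ 2) l g 0 z)) z))) ∧
    (∀ z ∈ Ioo (0 : ℝ) 1 ×ˢ {x : E | κ * ‖x‖ < ⟪x, e⟫}, ‖u (stAffine (l ^ 2) l g 0 z)‖ ≤ 1) ∧
    (∀ K ⊆ Ioo (0 : ℝ) 1 ×ˢ {x : E | κ * ‖x‖ < ⟪x, e⟫}, Bornology.IsBounded K → MeasurableSet K →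
      ∫⁻ z in K, ‖dt (fun z => u (stAffine (l ^ 2) l g 0 z)) z‖ₑ ^ 2 < ∞) := by
  set H : Set E := {x : E | κ * ‖x‖ < ⟪x, e⟫} with hH
  set Q : Set (ℝ × E) := Ioo (0 : ℝ) 1 ×ˢ H with hQ
  set Φ : ℝ × E → ℝ × E := stAffine (l ^ 2) l g 0 with hΦ
  have hΦ1 : ∀ z : ℝ × E, (Φ z).1 = g + l ^ 2 * z.1 := fun z => rfl
  have hΦ2 : ∀ z : ℝ × E, (Φ z).2 = l • z.2 := fun z => by simp [hΦ]
  have hΦH : ∀ z : ℝ × E, z.2 ∈ H → (Φ z).2 ∈ H := fun z hz => by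
    rw [hΦ2]; exact (smul_mem_coneSet_iff hl0 e z.2).2 hz
  have hl20 : 0 < l ^ 2 := by positivity
  have hQQ : Q ⊆ Φ ⁻¹' Q := by
    intro z hz
    refine ⟨⟨?_, ?_⟩, hΦH z hz.2⟩
    · rw [hΦ1]; nlinarith [mul_pos hl20 hz.1.1]
    · rw [hΦ1]; nlinarith [mul_lt_mul_of_pos_left hz.1.2 hl20]
  have hIQ : Ico (0 : ℝ) 1 ×ˢ H ⊆ Φ ⁻¹' (Ico g 1 ×ˢ H) := by
    intro z hz
    refine ⟨⟨?_, ?_⟩, hΦH z hz.2⟩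
    · rw [hΦ1]; nlinarith [mul_nonneg hl20.le hz.1.1]
    · rw [hΦ1]; nlinarith [mul_lt_mul_of_pos_left hz.1.2 hl20]
  refine ⟨(contDiffOn_comp_stAffine hu (l ^ 2) l g 0).mono hQQ, fun e' =>
    (contDiffOn_one_dx_comp_stAffine_c12 (by positivity) hl0.ne' hux g 0 e').mono hQQ,
    (continuousOn_comp_stAffine hcont (l ^ 2) l g 0).mono hIQ, ?_, ?_, ?_, ?_⟩
  · intro x hx
    have e1 : Φ ((0 : ℝ), x) = (g, l • x) := by simp [hΦ]
    show u (Φ ((0 : ℝ), x)) = 0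
    rw [e1]
    exact h0 _ ((smul_mem_coneSet_iff hl0 e x).2 hx)
  · intro z hz
    have h := backwardHeat_comp_stAffine (t₀ := g) (x₀ := (0 : E)) hc₁ hl0 hl1 hBH z (hQQ hz)
    refine h.trans (mul_le_mul_of_nonneg_right (mul_le_of_le_one_right hc₁ hl1) ?_)
    positivity
  · intro z hz
    exact hbound _ (hQQ hz)
  · intro K hK hKb hKm
    refine setLIntegral_enorm_dt_comp_stAffine_lt_top hl20 hl0 (hH3 _ ?_ ?_ ?_)
    · rintro w ⟨z, hz, rfl⟩; exact hQQ (hK hz)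
    · exact isBounded_image_stAffine hKb
    · exact measurableSet_image_stAffine hl20.ne' hl0.ne' hKm

set_option maxHeartbeats 1600000 in
/-- **Li–Šverák 2012, Lemma 2.4** ("Assume that for some `θ ∈ (2arccos(1/√3), π)` a function `u`
satisfies (2.1)–(2.3), then there is a number `γ₁(c₁) ∈ (0, γ/2)` such that `u(x,t) ≡ 0` in
`O_θ × (0, γ₁)`"), in the class `C¹₂`, for `|u| ≤ 1`, with unique continuation across spatial
boundaries ([ESS] Thm. 4.1) as the hypothesis `hUC`: for `0 < κ < 1/√3` and `c₁ ≥ 0` there is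
`γ₁ > 0` such that every `u` of class `C¹ ∩ {∂ₓu ∈ C¹}` on `]0,1[ × Γ_κ(e)`, continuous on
`[0,1[ × Γ_κ(e)` with `u(0,·) = 0`, with `∂ₜu` square integrable on bounded measurable subsets,
`|∂ₜu + Δu| ≤ c₁(|u| + |∇u|)` and `|u| ≤ 1`, vanishes on `]0, γ₁[ × Γ_κ(e)`. Proof (§2 of the
paper): the decay (2.8)–(2.9) (`decay_cone_c12`, `decay_gradient_cone_c12`), the narrower cone
`Γ_ε`, `ε = (κ + 1/√3)/2` ("the median of `θ` and `2arccos(1/√3)`"), on which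
`d(y) ≥ (ε - κ)‖y‖` gives (2.13), the rescaling (2.10) with `λ² = 2γ₁`, the Carleman step
(`cone_vanish_of_carleman_c12`) and the unique continuation step (`cone_uc_step_c12`).
[cite: LiSverak2012, Lemma 2.4] -/
theorem cone_strip_vanish_c12
    (hUC : ∀ (c R T : ℝ), 0 ≤ c → 0 < R → 0 < T → ∀ U : ℝ × E → F,
      ContDiffOn ℝ 1 U (Ioo (0 : ℝ) T ×ˢ ball (0 : E) R) →
      (∀ e' : E, ContDiffOn ℝ 1 (dx e' U) (Ioo (0 : ℝ) T ×ˢ ball (0 : E) R)) →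
      ContinuousOn U (Ico (0 : ℝ) T ×ˢ ball (0 : E) R) →
      (∀ z ∈ Ioo (0 : ℝ) T ×ˢ ball (0 : E) R,
        ‖dt U z + lap U z‖ ≤ c * (‖U z‖ + Real.sqrt (gradSq U z))) →
      (∀ k : ℕ, ∃ C : ℝ, ∀ z ∈ Ioo (0 : ℝ) T ×ˢ ball (0 : E) R,
        ‖U z‖ ≤ C * (‖z.2‖ + Real.sqrt z.1) ^ k) →
      ∀ x ∈ ball (0 : E) R, U (0, x) = 0)
    {κ : ℝ} (hκ0 : 0 < κ) (hκ : κ < 1 / Real.sqrt 3) :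
    ∀ c₁ : ℝ, 0 ≤ c₁ → ∃ γ₁ : ℝ, 0 < γ₁ ∧
      ∀ (e : E), ‖e‖ = 1 → ∀ (u : ℝ × E → F),
        ContDiffOn ℝ 1 u (Ioo (0 : ℝ) 1 ×ˢ {x : E | κ * ‖x‖ < ⟪x, e⟫}) →
        (∀ e' : E, ContDiffOn ℝ 1 (dx e' u) (Ioo (0 : ℝ) 1 ×ˢ {x : E | κ * ‖x‖ < ⟪x, e⟫})) →
        ContinuousOn u (Ico (0 : ℝ) 1 ×ˢ {x : E | κ * ‖x‖ < ⟪x, e⟫}) →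
        (∀ x : E, κ * ‖x‖ < ⟪x, e⟫ → u (0, x) = 0) →
        (∀ z ∈ Ioo (0 : ℝ) 1 ×ˢ {x : E | κ * ‖x‖ < ⟪x, e⟫},
          ‖dt u z + lap u z‖ ≤ c₁ * (‖u z‖ + Real.sqrt (gradSq u z))) →
        (∀ z ∈ Ioo (0 : ℝ) 1 ×ˢ {x : E | κ * ‖x‖ < ⟪x, e⟫}, ‖u z‖ ≤ 1) →
        (∀ K ⊆ Ioo (0 : ℝ) 1 ×ˢ {x : E | κ * ‖x‖ < ⟪x, e⟫}, Bornology.IsBounded K →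
          MeasurableSet K → ∫⁻ z in K, ‖dt u z‖ₑ ^ 2 < ∞) →
        ∀ t ∈ Ioo (0 : ℝ) γ₁, ∀ x : E, κ * ‖x‖ < ⟪x, e⟫ → u (t, x) = 0 := by
  -- ### the narrower cone and the Carleman parameters
  have hs3 : 0 < Real.sqrt 3 := Real.sqrt_pos.2 (by norm_num)
  have hs3' : (1 / Real.sqrt 3) ^ 2 = 1 / 3 := by
    rw [div_pow, one_pow, Real.sq_sqrt (by norm_num)]
  set ε : ℝ := (κ + 1 / Real.sqrt 3) / 2 with hε
  have hκε : κ < ε := by rw [hε]; linarith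
  have hε3 : ε < 1 / Real.sqrt 3 := by rw [hε]; linarith
  have hε0 : 0 < ε := by linarith
  have hε1 : ε < 1 := lt_trans hε3 one_div_sqrt_three_lt_one
  have hεsq : ε ^ 2 < 1 / 3 := by
    rw [← hs3']; exact pow_lt_pow_left₀ hε3 hε0.le two_ne_zero
  obtain ⟨β, hβ, hβ1, hκ', hm, hc₂⟩ := exists_cone_params hε0 hεsq
  set η : ℝ := ε ^ (2 * β) with hη
  have hη1 : η < 1 := Real.rpow_lt_one hε0.le hε1 (by linarith)
  have hκ1 : κ < 1 := lt_trans hκε hε1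
  -- ### the decay constants
  obtain ⟨βd, hβd, hdecay⟩ := decay_cone_c12 (E := E) (F := F)
  obtain ⟨Ci, hCi, hint⟩ := exists_sqrt_gradSq_le_of_backwardHeat_c12 E F
  intro c₁ hc₁
  obtain ⟨γ, c₂, hγ0, hγ12, hc₂0, hdec⟩ := hdecay c₁ hc₁
  have hγ1 : γ ≤ 1 := hγ12.trans (by norm_num)
  -- `L = λ²`
  obtain ⟨L, hL⟩ : ∃ L : ℝ, L = min (γ / 4) (1 / (96 * (c₁ ^ 2 + 1))) := ⟨_, rfl⟩
  have hL0 : 0 < L := by rw [hL]; exact lt_min (by positivity) (by positivity)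
  have hLγ : L ≤ γ / 4 := by rw [hL]; exact min_le_left _ _
  have hLc : L ≤ 1 / (96 * (c₁ ^ 2 + 1)) := by rw [hL]; exact min_le_right _ _
  have hL1 : L ≤ 1 / 4 := by linarith
  refine ⟨L / 2, by positivity, ?_⟩
  intro e he u hu hux hcont h0 hBH hbound hH3 t ht x hx
  -- ### the scale
  set l : ℝ := Real.sqrt L with hl
  have hl0 : 0 < l := Real.sqrt_pos.2 hL0
  have hl2 : l ^ 2 = L := Real.sq_sqrt hL0.le
  have hl1 : l ≤ 1 := by
    rw [hl, show (1 : ℝ) = Real.sqrt 1 by simp]; exact Real.sqrt_le_sqrt (by linarith)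
  have hsmall : (c₁ * l) ^ 2 ≤ 1 / 96 := by
    rw [mul_pow, hl2]
    have h1 : c₁ ^ 2 * L ≤ c₁ ^ 2 * (1 / (96 * (c₁ ^ 2 + 1))) := mul_le_mul_of_nonneg_left hLc (sq_nonneg _)
    have h2 : c₁ ^ 2 * (1 / (96 * (c₁ ^ 2 + 1))) ≤ 1 / 96 := by
      rw [mul_one_div, div_le_div_iff₀ (by positivity) (by norm_num)]; nlinarith [sq_nonneg c₁]
    linarith
  -- ### the sets
  set H : Set E := {x : E | κ * ‖x‖ < ⟪x, e⟫} with hH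
  set Q : Set (ℝ × E) := Ioo (0 : ℝ) 1 ×ˢ H with hQ
  set O : Set (ℝ × E) := Ioo (1 / 2 : ℝ) (3 / 2) ×ˢ H with hO
  have hHo : IsOpen H := isOpen_coneSet κ e
  have hD : ∀ y : E, ε * ‖y‖ < ⟪y, e⟫ → 1 < ⟪y, e⟫ → y ∈ H := by
    intro y hy _
    show κ * ‖y‖ < ⟪y, e⟫
    nlinarith [norm_nonneg y]
  -- ### the rescaled function `v(s, y) = u(λ²(s - 1/2), λ y)`
  set Φ : ℝ × E → ℝ × E := stAffine (l ^ 2) l (-(l ^ 2 / 2)) 0 with hΦdef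
  set v : ℝ × E → F := fun z => u (Φ z) with hv
  have hΦ1 : ∀ z : ℝ × E, (Φ z).1 = l ^ 2 * (z.1 - 1 / 2) := fun z => by
    simp only [hΦdef, stAffine_fst]; ring
  have hΦ2 : ∀ z : ℝ × E, (Φ z).2 = l • z.2 := fun z => by simp [hΦdef]
  have hΦn : ∀ z : ℝ × E, ⟪(Φ z).2, e⟫ = l * ⟪z.2, e⟫ := fun z => by
    rw [hΦ2, inner_smul_left]; simp
  have hΦnorm : ∀ z : ℝ × E, ‖(Φ z).2‖ = l * ‖z.2‖ := fun z => by
    rw [hΦ2, norm_smul, Real.norm_eq_abs, abs_of_pos hl0]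
  have hΦH : ∀ z : ℝ × E, z.2 ∈ H → (Φ z).2 ∈ H := fun z hz => by
    rw [hΦ2]; exact (smul_mem_coneSet_iff hl0 e z.2).2 hz
  have hOQ : O ⊆ Φ ⁻¹' Q := by
    intro z hz
    refine ⟨⟨?_, ?_⟩, hΦH z hz.2⟩
    · rw [hΦ1]; exact mul_pos (by positivity) (by linarith [hz.1.1])
    · rw [hΦ1]; nlinarith [hz.1.2, hl2]
  have hv2 : ContDiffOn ℝ 1 v O := (contDiffOn_comp_stAffine hu (l ^ 2) l (-(l ^ 2 / 2)) 0).mono hOQ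
  have hv2x : ∀ e' : E, ContDiffOn ℝ 1 (dx e' v) O := fun e' =>
    (contDiffOn_one_dx_comp_stAffine_c12 (by positivity) hl0.ne' hux (-(l ^ 2 / 2)) 0 e').mono hOQ
  have hvBH : ∀ z ∈ O, ‖dt v z + lap v z‖ ≤ (c₁ * l) * (‖v z‖ + Real.sqrt (gradSq v z)) :=
    fun z hz => backwardHeat_comp_stAffine hc₁ hl0 hl1 hBH z (hOQ hz)
  have hIQ : Icc (1 / 2 : ℝ) 1 ×ˢ H ⊆ Φ ⁻¹' (Ico (0 : ℝ) 1 ×ˢ H) := by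
    intro z hz
    refine ⟨⟨?_, ?_⟩, hΦH z hz.2⟩
    · rw [hΦ1]; exact mul_nonneg (by positivity) (by linarith [hz.1.1])
    · rw [hΦ1]; nlinarith [hz.1.2, hl2]
  have hvcont : ContinuousOn v (Icc (1 / 2 : ℝ) 1 ×ˢ H) :=
    (continuousOn_comp_stAffine hcont (l ^ 2) l (-(l ^ 2 / 2)) 0).mono hIQ
  have hv0 : ∀ y ∈ H, v (1 / 2, y) = 0 := by
    intro y hy
    show u (Φ ((1 / 2 : ℝ), y)) = 0
    have e1 : Φ ((1 / 2 : ℝ), y) = ((0 : ℝ), l • y) := by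
      refine Prod.ext ?_ ?_
      · rw [hΦ1]; simp
      · rw [hΦ2]
    rw [e1]
    exact h0 _ ((smul_mem_coneSet_iff hl0 e y).2 hy)
  have hvH3 : ∀ K ⊆ O, Bornology.IsBounded K → MeasurableSet K → ∫⁻ z in K, ‖dt v z‖ₑ ^ 2 < ∞ := by
    intro K hK hKb hKm
    refine setLIntegral_enorm_dt_comp_stAffine_lt_top (by positivity) hl0 (hH3 _ ?_ ?_ ?_)
    · rintro w ⟨z, hz, rfl⟩; exact hOQ (hK hz)
    · exact isBounded_image_stAffine hKb
    · exact measurableSet_image_stAffine (by positivity) hl0.ne' hKm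
  -- ### (2.13) for `v`: via the gradient decay (2.9)
  have hdecu : ∀ t ∈ Ioo (0 : ℝ) γ, ∀ x : E, 4 ≤ ⟪x, e⟫ - κ * ‖x‖ →
      ‖u (t, x)‖ ≤ c₂ * Real.exp (-(βd * (⟪x, e⟫ - κ * ‖x‖) ^ 2 / t)) :=
    hdec κ hκ0.le hκ1.le e he u hu hux hcont h0 hBH hbound hH3
  have hgd := decay_gradient_cone_c12 hCi hint he hκ0.le hκ1.le hc₁ hc₂0.le hβd hγ1 hu hux hBH hdecu
  set c₉ : ℝ := c₂ * (1 + Ci * (1 + c₁) * (1 / 2 / (Real.exp 1 * (2 * βd))) ^ (1 / 2 : ℝ)) with hc₉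
  set Y₀ : ℝ := 8 / (l * (ε - κ)) with hY₀
  have hεκ : 0 < ε - κ := by linarith
  set β' : ℝ := βd * (ε - κ) ^ 2 / 4 with hβ'
  have hβ'0 : 0 < β' := by rw [hβ']; positivity
  have hvdec : ∀ z ∈ O, z.1 < 1 → ε * ‖z.2‖ < ⟪z.2, e⟫ → Y₀ ≤ ⟪z.2, e⟫ →
      ‖v z‖ + Real.sqrt (gradSq v z) ≤ c₉ * Real.exp (-(β' * ‖z.2‖ ^ 2)) := by
    intro z hz hz1 hzc hzn
    have hs : 0 < z.1 - 1 / 2 := by linarith [hz.1.1]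
    have ht' : (Φ z).1 ∈ Ioo (0 : ℝ) (γ / 2) := by
      rw [hΦ1]; exact ⟨mul_pos (by positivity) hs, by nlinarith [hl2]⟩
    -- the gap at `λ y`: `g(λy) = λ g(y) ≥ λ(ε - κ)‖y‖ ≥ 8`
    have hgy : (ε - κ) * ‖z.2‖ < ⟪z.2, e⟫ - κ * ‖z.2‖ := by linarith
    have hry : ⟪z.2, e⟫ ≤ ‖z.2‖ := by
      have := real_inner_le_norm z.2 e; rwa [he, mul_one] at this
    have hg8 : 8 ≤ ⟪(Φ z).2, e⟫ - κ * ‖(Φ z).2‖ := by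
      rw [hΦn, hΦnorm]
      have h1 : 8 / (l * (ε - κ)) ≤ ‖z.2‖ := hzn.trans hry
      rw [div_le_iff₀ (by positivity)] at h1
      have h2 : l * ((ε - κ) * ‖z.2‖) ≤ l * (⟪z.2, e⟫ - κ * ‖z.2‖) :=
        mul_le_mul_of_nonneg_left hgy.le hl0.le
      nlinarith
    have h1 := hgd (Φ z).1 ht' (Φ z).2 hg8
    rw [Prod.mk.eta] at h1
    have hgv : Real.sqrt (gradSq v z) ≤ Real.sqrt (gradSq u (Φ z)) := by
      rw [hv, gradSq_comp_stAffine (by positivity) hl0.ne', Real.sqrt_mul (sq_nonneg _),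
        Real.sqrt_sq hl0.le]
      exact mul_le_of_le_one_left (Real.sqrt_nonneg _) hl1
    have h2 : ‖v z‖ + Real.sqrt (gradSq v z) ≤ ‖u (Φ z)‖ + Real.sqrt (gradSq u (Φ z)) :=
      add_le_add le_rfl hgv
    refine h2.trans (h1.trans ?_)
    refine mul_le_mul_of_nonneg_left (Real.exp_le_exp.2 ?_) (by rw [hc₉]; positivity)
    rw [neg_le_neg_iff, hΦ1, hΦn, hΦnorm]
    -- `β'‖y‖² ≤ βd (λ(⟪y,e⟫ - κ‖y‖))² / (8 λ²(s - 1/2))`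
    have hden : 0 < 8 * (l ^ 2 * (z.1 - 1 / 2)) := by positivity
    rw [le_div_iff₀ hden, hβ']
    have h3 : (ε - κ) ^ 2 * ‖z.2‖ ^ 2 ≤ (⟪z.2, e⟫ - κ * ‖z.2‖) ^ 2 := by
      rw [← mul_pow]; exact pow_le_pow_left₀ (by positivity) hgy.le 2
    have h4 : z.1 - 1 / 2 ≤ 1 / 2 := by linarith
    have h5 : (l * ⟪z.2, e⟫ - κ * (l * ‖z.2‖)) ^ 2 = l ^ 2 * (⟪z.2, e⟫ - κ * ‖z.2‖) ^ 2 := by ring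
    rw [h5]
    have h6 : 0 ≤ βd * l ^ 2 := by positivity
    calc βd * (ε - κ) ^ 2 / 4 * ‖z.2‖ ^ 2 * (8 * (l ^ 2 * (z.1 - 1 / 2)))
        = βd * l ^ 2 * ((ε - κ) ^ 2 * ‖z.2‖ ^ 2) * (2 * (z.1 - 1 / 2)) := by ring
      _ ≤ βd * l ^ 2 * (⟪z.2, e⟫ - κ * ‖z.2‖) ^ 2 * 1 := by
          refine mul_le_mul (mul_le_mul_of_nonneg_left h3 h6) (by linarith) (by linarith) ?_
          positivity
      _ = βd * (l ^ 2 * (⟪z.2, e⟫ - κ * ‖z.2‖) ^ 2) := by ring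
  -- ### the Carleman step
  have hvan := cone_vanish_of_carleman_c12 (D := H) (Cd := c₉) (Y₀ := Y₀) he hβ hβ1 hε0 hε1.le rfl
    hκ' hm hc₂ hsmall hβ'0 hHo hD hv2 hv2x hvBH hvcont hv0 hvH3 hvdec
  -- ### unique continuation
  have huc := cone_uc_step_c12 hUC he (by positivity : 0 ≤ c₁ * l) hκ0.le hκ1 hκε.le hε1
    hβ.le hη1 hv2 hv2x hvBH hvan
  -- ### back to `u`
  obtain ⟨ht0, htL⟩ := ht
  set s₀ : ℝ := 1 / 2 + t / l ^ 2 with hs₀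
  have hs₀mem : s₀ ∈ Ioo (1 / 2 : ℝ) 1 := by
    rw [hs₀, hl2]
    refine ⟨by linarith [div_pos ht0 hL0], ?_⟩
    have : t / L < 1 / 2 := by rw [div_lt_iff₀ hL0]; linarith
    linarith
  have h := huc s₀ hs₀mem (l⁻¹ • x) ((smul_mem_coneSet_iff (inv_pos.2 hl0) e x).2 hx)
  have e1 : v (s₀, l⁻¹ • x) = u (t, x) := by
    show u (Φ (s₀, l⁻¹ • x)) = u (t, x)
    congr 1
    refine Prod.ext ?_ ?_
    · rw [hΦ1, hs₀]; field_simp; ring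
    · rw [hΦ2, smul_smul, mul_inv_cancel₀ hl0.ne', one_smul]
  rw [e1] at h
  exact h

end ConeStrip

/-! ### Theorem 1.1 by iteration -/

section ConeIterate

variable {E : Type*} [NormedAddCommGroup E] [InnerProductSpace ℝ E] [FiniteDimensional ℝ E]
  [MeasurableSpace E] [BorelSpace E]
variable {F : Type*} [NormedAddCommGroup F] [InnerProductSpace ℝ F] [CompleteSpace F]

set_option maxHeartbeats 800000 in
/-- **Li–Šverák 2012, Theorem 1.1 in the class `C¹₂`** (for any finite-dimensional `E`, with
unique continuation across spatial boundaries as the hypothesis `hUC`): if `0 < κ < 1/√3` and `u`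
is of class `C¹ ∩ {∂ₓu ∈ C¹}` on `Q = ]0,1[ × Γ_κ(e)`, continuous on `[0,1[ × Γ_κ(e)` with
`u(0, ·) = 0`, has `∂ₜu` square integrable on bounded measurable subsets of `Q`, and satisfies
`|∂ₜu + Δu| ≤ c₁(|u| + |∇u|)`, `|u| ≤ 1`, then `u ≡ 0` on `Q`. Proof: Lemma 2.4
(`cone_strip_vanish_c12`) and the iteration `t_{k+1} = t_k + γ₁λ_k²` with the rescalings
`cone_rescale_hypotheses_c12` (the cone is scale invariant). [cite: LiSverak2012, Thm. 1.1 and §2] -/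
theorem cone_backwardUniqueness_c12
    (hUC : ∀ (c R T : ℝ), 0 ≤ c → 0 < R → 0 < T → ∀ U : ℝ × E → F,
      ContDiffOn ℝ 1 U (Ioo (0 : ℝ) T ×ˢ ball (0 : E) R) →
      (∀ e' : E, ContDiffOn ℝ 1 (dx e' U) (Ioo (0 : ℝ) T ×ˢ ball (0 : E) R)) →
      ContinuousOn U (Ico (0 : ℝ) T ×ˢ ball (0 : E) R) →
      (∀ z ∈ Ioo (0 : ℝ) T ×ˢ ball (0 : E) R,
        ‖dt U z + lap U z‖ ≤ c * (‖U z‖ + Real.sqrt (gradSq U z))) →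
      (∀ k : ℕ, ∃ C : ℝ, ∀ z ∈ Ioo (0 : ℝ) T ×ˢ ball (0 : E) R,
        ‖U z‖ ≤ C * (‖z.2‖ + Real.sqrt z.1) ^ k) →
      ∀ x ∈ ball (0 : E) R, U (0, x) = 0)
    {κ : ℝ} (hκ0 : 0 < κ) (hκ : κ < 1 / Real.sqrt 3)
    {u : ℝ × E → F} {e : E} (he : ‖e‖ = 1) {c₁ : ℝ} (hc₁ : 0 ≤ c₁)
    (hu : ContDiffOn ℝ 1 u (Ioo (0 : ℝ) 1 ×ˢ {x : E | κ * ‖x‖ < ⟪x, e⟫}))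
    (hux : ∀ e' : E, ContDiffOn ℝ 1 (dx e' u) (Ioo (0 : ℝ) 1 ×ˢ {x : E | κ * ‖x‖ < ⟪x, e⟫}))
    (hcont : ContinuousOn u (Ico (0 : ℝ) 1 ×ˢ {x : E | κ * ‖x‖ < ⟪x, e⟫}))
    (h0 : ∀ x : E, κ * ‖x‖ < ⟪x, e⟫ → u (0, x) = 0)
    (hBH : ∀ z ∈ Ioo (0 : ℝ) 1 ×ˢ {x : E | κ * ‖x‖ < ⟪x, e⟫},
      ‖dt u z + lap u z‖ ≤ c₁ * (‖u z‖ + Real.sqrt (gradSq u z)))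
    (hbound : ∀ z ∈ Ioo (0 : ℝ) 1 ×ˢ {x : E | κ * ‖x‖ < ⟪x, e⟫}, ‖u z‖ ≤ 1)
    (hH3 : ∀ K ⊆ Ioo (0 : ℝ) 1 ×ˢ {x : E | κ * ‖x‖ < ⟪x, e⟫}, Bornology.IsBounded K → MeasurableSet K →
      ∫⁻ z in K, ‖dt u z‖ₑ ^ 2 < ∞) :
    ∀ z ∈ Ioo (0 : ℝ) 1 ×ˢ {x : E | κ * ‖x‖ < ⟪x, e⟫}, u z = 0 := by
  obtain ⟨γ₁, hγ₁, hsv⟩ := cone_strip_vanish_c12 (E := E) (F := F) hUC hκ0 hκ c₁ hc₁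
  set H : Set E := {x : E | κ * ‖x‖ < ⟪x, e⟫} with hH
  set Q : Set (ℝ × E) := Ioo (0 : ℝ) 1 ×ˢ H with hQ
  have hHo : IsOpen H := isOpen_coneSet κ e
  have hQo : IsOpen Q := isOpen_Ioo.prod hHo
  -- the step `δ = (1/2) min γ₁ 1`
  obtain ⟨γ₂, hγ₂⟩ : ∃ γ₂ : ℝ, γ₂ = min γ₁ 1 := ⟨_, rfl⟩
  have hγ₂0 : 0 < γ₂ := by rw [hγ₂]; exact lt_min hγ₁ zero_lt_one
  have hγ₂1 : γ₂ ≤ 1 := by rw [hγ₂]; exact min_le_right _ _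
  have hγ₂γ : γ₂ ≤ γ₁ := by rw [hγ₂]; exact min_le_left _ _
  obtain ⟨δ, hδ⟩ : ∃ δ : ℝ, δ = 1 / 2 * γ₂ := ⟨_, rfl⟩
  have hδ0 : 0 < δ := by rw [hδ]; positivity
  have hδ1 : δ < 1 := by rw [hδ]; linarith
  -- ### the induction: `u = 0` on `]0, 1 - (1-δ)^k[ × H`
  have hind : ∀ k : ℕ, ∀ z ∈ Q, z.1 < 1 - (1 - δ) ^ k → u z = 0 := by
    intro k
    induction k with
    | zero => intro z hz hlt; simp at hlt; linarith [hz.1.1]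
    | succ k ih =>
      intro z hz hlt
      set g : ℝ := 1 - (1 - δ) ^ k with hg
      have hpk : 0 < (1 - δ) ^ k := pow_pos (by linarith) k
      have hpk1 : (1 - δ) ^ k ≤ 1 := pow_le_one₀ (by linarith) (by linarith)
      have hg0 : 0 ≤ g := by rw [hg]; linarith
      have hg1 : g < 1 := by rw [hg]; linarith
      rcases lt_trichotomy z.1 g with hlt' | heq | hgt
      · exact ih z hz hlt'
      · -- `t = g > 0`: continuity from below
        have hgpos : 0 < g := by rw [← heq]; exact hz.1.1
        have hmem : ((g, z.2) : ℝ × E) ∈ Q := ⟨⟨hgpos, hg1⟩, hz.2⟩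
        have hcz : ContinuousAt u (g, z.2) := hu.continuousOn.continuousAt (hQo.mem_nhds hmem)
        have hz' : z = (g, z.2) := by rw [← heq]
        rw [hz']
        refine eq_zero_of_vanish_below hgpos hcz fun t ht => ?_
        exact ih (t, z.2) ⟨⟨by linarith [ht.1], by linarith [ht.2]⟩, hz.2⟩ ht.2
      · -- `t > g`: the rescaled function `w(s, y) = u(g + l² s, l y)`, `l² = (1-δ)^k / 2`
        set l : ℝ := Real.sqrt ((1 - δ) ^ k * (1 / 2)) with hl
        have hl0 : 0 < l := Real.sqrt_pos.2 (by positivity)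
        have hl2 : l ^ 2 = (1 - δ) ^ k * (1 / 2) := Real.sq_sqrt (by positivity)
        have hl1 : l ≤ 1 := by
          rw [hl]
          calc Real.sqrt ((1 - δ) ^ k * (1 / 2)) ≤ Real.sqrt 1 :=
                Real.sqrt_le_sqrt (by nlinarith)
            _ = 1 := Real.sqrt_one
        have hgl : g + l ^ 2 ≤ 1 := by rw [hl2, hg]; nlinarith
        -- continuity on `[g, 1[ × H` and vanishing at `t = g`
        have hcontg : ContinuousOn u (Ico g 1 ×ˢ H) := by
          rcases eq_or_lt_of_le hg0 with hg00 | hg00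
          · rw [← hg00]; exact hcont
          · exact hu.continuousOn.mono (Set.prod_mono (fun t ht => ⟨by linarith [ht.1], ht.2⟩) Subset.rfl)
        have h0g : ∀ x : E, κ * ‖x‖ < ⟪x, e⟫ → u (g, x) = 0 := by
          intro x hx
          rcases eq_or_lt_of_le hg0 with hg00 | hg00
          · rw [← hg00]; exact h0 x hx
          · have hmem : ((g, x) : ℝ × E) ∈ Q := ⟨⟨hg00, hg1⟩, hx⟩
            have hcz : ContinuousAt u (g, x) := hu.continuousOn.continuousAt (hQo.mem_nhds hmem)
            refine eq_zero_of_vanish_below hg00 hcz fun t ht => ?_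
            exact ih (t, x) ⟨⟨by linarith [ht.1], by linarith [ht.2]⟩, hx⟩ ht.2
        obtain ⟨hw2, hw2x, hwc, hw0, hwBH, hwbd, hwH3⟩ := cone_rescale_hypotheses_c12 (e := e) hc₁ hl0
          hl1 hg0 hgl hu hux hcontg h0g hBH hbound hH3
        have hzero := hsv e he (fun w => u (stAffine (l ^ 2) l g 0 w)) hw2 hw2x hwc hw0 hwBH hwbd hwH3
        -- the point `z` in the new coordinates
        set s : ℝ := (z.1 - g) / l ^ 2 with hs
        have hs0 : 0 < s := by rw [hs]; exact div_pos (by linarith) (by positivity)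
        have hsγ : s < γ₁ := by
          rw [hs, div_lt_iff₀ (by positivity), hl2]
          have e1 : 1 - (1 - δ) ^ (k + 1) = g + (1 - δ) ^ k * δ := by rw [hg]; ring
          rw [e1] at hlt
          have hδ' : δ ≤ 1 / 2 * γ₁ := by rw [hδ]; linarith
          have : (1 - δ) ^ k * δ ≤ γ₁ * ((1 - δ) ^ k * (1 / 2)) := by
            calc (1 - δ) ^ k * δ ≤ (1 - δ) ^ k * (1 / 2 * γ₁) := mul_le_mul_of_nonneg_left hδ' hpk.le
              _ = γ₁ * ((1 - δ) ^ k * (1 / 2)) := by ring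
          linarith
        have h := hzero s ⟨hs0, hsγ⟩ (l⁻¹ • z.2) ((smul_mem_coneSet_iff (inv_pos.2 hl0) e z.2).2 hz.2)
        have e2 : stAffine (l ^ 2) l g 0 (s, l⁻¹ • z.2) = z := by
          refine Prod.ext ?_ ?_
          · simp only [stAffine_fst, hs]; field_simp; ring
          · simp only [stAffine_snd, zero_add, smul_smul, mul_inv_cancel₀ hl0.ne', one_smul]
        rw [e2] at h
        exact h
  -- ### conclusion
  intro z hz
  obtain ⟨k, hk⟩ := exists_pow_lt_of_lt_one (by linarith [hz.1.2] : 0 < 1 - z.1) (by linarith : 1 - δ < 1)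
  exact hind k z hz (by linarith)

end ConeIterate

end Carleman

/-! ### The discharge of the named fact -/

section Discharge

/-- **Discharge of `coneBackwardUniquenessC12` (Li–Šverák 2012, Thm. 1.1, in the class `C¹₂`)**:
the case `κ = 0` is the half-space theorem `ConeBU.halfspace` (ESS 2003, Thm. 5.1), and for
`0 < κ < 1/√3` it is `Carleman.cone_backwardUniqueness_c12` on `ℝ³` with unique continuation
across spatial boundaries (ESS 2003, Thm. 4.1 = `Carleman.uniqueContinuation_uncurried_c12 3 3`)
as its input. [cite: LiSverak2012, Thm. 1.1] -/
theorem coneBackwardUniquenessC12_holds : coneBackwardUniquenessC12 := by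
  intro κ hκ0 hκ e he
  rcases eq_or_lt_of_le hκ0 with h | h
  · rw [← h]; exact ConeBU.halfspace e he
  · intro v c₁ hc₁ hv hvx hcont h0 hBH hbd hH3
    exact Carleman.cone_backwardUniqueness_c12 (E := EuclideanSpace ℝ (Fin 3))
      (F := EuclideanSpace ℝ (Fin 3))
      (fun _ _ _ hc hR hT _ hU hUx hUc hineq hvan =>
        Carleman.uniqueContinuation_uncurried_c12 3 3 hc hR hT hU hUx hUc hineq hvan)
      h hκ he hc₁ hv hvx hcont h0 hBH hbd hH3

end Discharge

end Literature.Analysis.FluidPDE
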